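import Literature.NumberTheory.EllipticCurves.ZpExtensionGaloisTwistLocalKummer
import Literature.NumberTheory.EllipticCurves.QuadraticTwistPointsOverSqrtField
import Literature.NumberTheory.EllipticCurves.QuadraticTwistSelmerPInfty
import Literature.NumberTheory.EllipticCurves.LocalKummerIsotropyTransport
import Literature.NumberTheory.EllipticCurves.CyclotomicZpExtensionLayerOneSqrtTwoProofs
import Literature.NumberTheory.EllipticCurves.Kobayashi2003.SignedSelmer
import Summits.BirchSwinnertonDyer.BirchSwinnertonDyer.Theorems.ByReductionTypeAtTwoSupersingularFlatBlindTwistedInfRes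
import HarnessLib

/-!
# The twist dictionary for the `ψ₂`-twisted descent at `p = 2`: `E[2^J](χ₋₁) ≅ E₂[2^J]` along the
# cyclotomic `ℤ₂`-extension of `ℚ`, and the Kummer image of `E₂(ℚ₂)` inside the Kummer line of the
# `ψ₂`-vectors (hand HT-2 of crux `SupersingularRankZeroAtTwo`, line `odd_blind_package`, slot 5 / CDF_glob)

Cell `bsd-2adic` (run/shared/lean/pub/bsd-2adic/), seat `bsd-2adic-tower-1` GEN 58, `--supports
stmt-BirchSwinnertonDyer-19097` (helper). HONEST FRAMING: THEOREMS ONLY (no `def`, no named fact, no instance,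
no `sorry`); nothing is booked; `SupersingularRankZeroAtTwo`, CDF_glob and BSD are NOT proved by any of this.

## What

For the cyclotomic `ℤ₂`-extension `κ` of `ℚ` the character `χ₋₁ : σ ↦ (−1)^{κ(σ)}` is the quadratic character
of the first layer `ℚ_1 = ℚ(√2)` (tree: `IsCyclotomic.exists_sq_eq_two_layer_one`, `finrank`/`index` of the
layer). Hence Greenberg's twisted module `M_J = E[2^J](χ₋₁) = W.twistedTorsionGaloisModule 2 κ J (-1) two_dvd_neg_one_sub_one` is the
`2^J`-torsion of the quadratic twist `E₂ = W₂` (`C • W.quadraticTwist 2 = W₂`), as `Γ_ℚ`-modules: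

* §1 `smul_eq_of_mem_layerSubgroup_one` / `smul_eq_neg_of_not_mem_layerSubgroup_one`: an element `θ ∈ ℚ_1`
  with `θ² = 2` is fixed by `σ ∈ Gal(ℚ̄/ℚ_1) = κ⁻¹(2ℤ₂)` and negated by every other `σ` (index `2` +
  irrationality of `√2`);
* §2 `mem_layerSubgroup_one_iff_two_dvd_twistExponent`: `σ ∈ κ⁻¹(2ℤ₂) ⟺ 2 ∣ (κ σ mod 2^J)` (`J ≥ 1`);
* §3 `map_localKummerClass_mem_twistedTorsionLocalKummer` (generic): along ANY additive isomorphism of points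
  `g : Y(K̄) ≃+ W(K̄)` with a local companion `g_E : Y(K̄_E) ≃+ W(K̄_E)` (`pointsMap ∘ g = g_E ∘ pointsMap`) that is
  `Gal(K̄_E/(K_∞)_w)`-equivariant, an intertwining map `φ : Y[n] → M` with underlying map `g` carries the local
  Kummer class of `Q` to a class of the twisted local Kummer condition cut out by any `A ∋ p^k • g_E Q`;
* the dictionary itself (`exists_intertwining_twist`, sibling file `…FlatBlindTwistSideKummerLine.lean`, same seat):
  mutually inverse `Γ_ℚ`-intertwining maps `φ_J : W₂[2^J] ⇄ M_J : ψ_J` such that `H¹(φ_J)` maps the local Kummer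
  condition of `W₂` at `ℚ_v` INTO the Kummer line `K_J` of the `ψ₂`-vectors.

Consumer (same seat): the hand `HT2_exists_bound_strict_mul_relindex` (`…FlatBlindTwistSide.lean`), which transports
the three Selmer structures of the hand along `φ_J` to Selmer structures on `W₂[2^J]`.

References: [GreenbergLNM1716] §4 pp. 105–107, 122–124 (the modules `A_s`, «as `G_{F_∞}`-modules `A_s = E[p^∞]`»);
[SilvermanAEC2009] X.2 Prop. 2.4, X.5 Cor. 5.4 (the twist isomorphism and its sign rule), VIII.§2, X.§4 (Kummer
classes); [Washington1997] §13.1 (`ℚ_1 = ℚ(√2)`); [Kobayashi2003] Def. 1.1 (local layer points).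
-/

set_option autoImplicit false
set_option linter.dupNamespace false

noncomputable section

open scoped Classical

universe u

namespace Summit.BirchSwinnertonDyer.BirchSwinnertonDyer.Theorems.FlatBlindTwistSide

open Field NumberField IsDedekindDomain WeierstrassCurve CategoryTheory
open Literature.NumberTheory.EllipticCurves Literature.NumberTheory.GaloisRepresentations
  Literature.NumberTheory.EllipticCurves.ZpExtension Literature.NumberTheory.EllipticCurves.Kobayashi2003
open scoped ContRepresentation
open Summit.BirchSwinnertonDyer.BirchSwinnertonDyer.Theorems.OddBlindTwist (two_dvd_neg_one_sub_one)

/-! ## §1 The first layer `ℚ_1 = ℚ(√2)`: how `Γ_ℚ` moves a square root of `2` in `ℚ_1` -/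

/-- An element of the first layer `ℚ_1 = ℚ̄^{κ⁻¹(2ℤ₂)}` is fixed by `κ⁻¹(2ℤ₂)`. [cite: Washington1997, §13.1] -/
theorem smul_eq_of_mem_layerSubgroup_one {κ : ZpExtension ℚ 2} {θ : AlgebraicClosure ℚ} (hθ : θ ∈ κ.layer 1)
    {σ : absoluteGaloisGroup ℚ} (hσ : σ ∈ κ.layerSubgroup 1) : σ • θ = θ :=
  (IntermediateField.mem_fixedField_iff _ θ).mp hθ _ ⟨σ, hσ, rfl⟩

/-- **`σ ∉ Gal(ℚ̄/ℚ_1)` negates `√2 ∈ ℚ_1`.** The stabiliser of `θ` contains the index-`2` subgroup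
`κ⁻¹(2ℤ₂)`; it is not all of `Γ_ℚ` (`θ² = 2`, `θ ∉ ℚ`), so it IS `κ⁻¹(2ℤ₂)`; and `(σθ)² = 2` leaves `σθ = −θ`.
[cite: Washington1997, §13.1] -/
theorem smul_eq_neg_of_not_mem_layerSubgroup_one {κ : ZpExtension ℚ 2} {θ : AlgebraicClosure ℚ}
    (hθ : θ ∈ κ.layer 1) (hθ2 : θ ^ 2 = 2) {σ : absoluteGaloisGroup ℚ} (hσ : σ ∉ κ.layerSubgroup 1) :
    σ • θ = -θ := by
  haveI : IsGalois ℚ (AlgebraicClosure ℚ) :=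
    @IsAlgClosure.isGalois ℚ (AlgebraicClosure ℚ) _ _ (AlgebraicClosure.instAlgebra ℚ) inferInstance
      inferInstance
  -- the stabiliser of `θ`
  set S : Subgroup (absoluteGaloisGroup ℚ) := MulAction.stabilizer (absoluteGaloisGroup ℚ) θ with hS
  have hle : κ.layerSubgroup 1 ≤ S := fun τ hτ ↦ by
    rw [hS, MulAction.mem_stabilizer_iff]
    exact smul_eq_of_mem_layerSubgroup_one hθ hτ
  have hidx : (κ.layerSubgroup 1).index = 2 := by rw [κ.index_layerSubgroup 1, pow_one]
  -- `S ≠ ⊤`: otherwise `θ` is rational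
  have hne : S ≠ ⊤ := by
    intro htop
    have hfix : ∀ τ : absoluteGaloisGroup ℚ, τ • θ = θ := fun τ ↦ by
      have hτ : τ ∈ S := by rw [htop]; exact Subgroup.mem_top τ
      rw [hS, MulAction.mem_stabilizer_iff] at hτ
      exact hτ
    have hbot : θ ∈ (⊥ : IntermediateField ℚ (AlgebraicClosure ℚ)) := by
      rw [← InfiniteGalois.fixedField_fixingSubgroup (⊥ : IntermediateField ℚ (AlgebraicClosure ℚ)),
        IntermediateField.fixingSubgroup_bot, IntermediateField.mem_fixedField_iff]
      intro g _
      exact hfix ((absoluteGaloisGroup.toAlgEquiv ℚ).symm g)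
    obtain ⟨q, hq⟩ := IntermediateField.mem_bot.mp hbot
    have hq2 : (algebraMap ℚ (AlgebraicClosure ℚ)) (q ^ 2) = (algebraMap ℚ (AlgebraicClosure ℚ)) 2 := by
      rw [map_pow, hq, hθ2, map_ofNat]
    have hq' : q ^ 2 = 2 := (algebraMap ℚ (AlgebraicClosure ℚ)).injective hq2
    -- no rational number has square `2`
    have hreal : ((|q| : ℚ) : ℝ) = Real.sqrt 2 := by
      rw [Rat.cast_abs, ← Real.sqrt_sq_eq_abs, ← Rat.cast_pow, hq']; norm_num
    exact irrational_sqrt_two.ne_rat |q| hreal.symm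
  -- hence `S = κ⁻¹(2ℤ₂)`
  have hSeq : S = κ.layerSubgroup 1 := by
    have hdvd : S.index ∣ 2 := hidx ▸ Subgroup.index_dvd_of_le hle
    rcases (Nat.dvd_prime Nat.prime_two).mp hdvd with h1 | h2
    · exact absurd (Subgroup.index_eq_one.mp h1) hne
    · have hrel := Subgroup.relIndex_mul_index hle
      rw [h2, hidx] at hrel
      have h1 : (κ.layerSubgroup 1).relIndex S = 1 := by omega
      exact le_antisymm (Subgroup.relIndex_eq_one.mp h1) hle
  have hσS : σ • θ ≠ θ := by
    intro h
    apply hσ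
    rw [← hSeq, hS, MulAction.mem_stabilizer_iff]
    exact h
  -- `(σθ)² = 2`
  have hsq : (σ • θ) ^ 2 = θ ^ 2 := by
    rw [← smul_pow', hθ2]
    exact map_ofNat (absoluteGaloisGroup.toAlgEquiv ℚ σ) 2
  have hmul : (σ • θ - θ) * (σ • θ + θ) = 0 := by
    have : (σ • θ - θ) * (σ • θ + θ) = (σ • θ) ^ 2 - θ ^ 2 := by ring
    rw [this, hsq, sub_self]
  rcases mul_eq_zero.mp hmul with h | h
  · exact absurd (sub_eq_zero.mp h) hσS
  · exact eq_neg_of_add_eq_zero_left h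

/-- For a cyclotomic `κ` there is `θ ∈ ℚ_1` with `θ² = 2`, fixed exactly by `κ⁻¹(2ℤ₂)` and negated by the
other coset (`ℚ_1 = ℚ(√2)`). [cite: Washington1997, §13.1] -/
theorem exists_sqrt_two_smul {κ : ZpExtension ℚ 2} (hκ : κ.IsCyclotomic) :
    ∃ θ : AlgebraicClosure ℚ, θ ^ 2 = algebraMap ℚ (AlgebraicClosure ℚ) 2 ∧
      (∀ σ : absoluteGaloisGroup ℚ, σ ∈ κ.layerSubgroup 1 → σ • θ = θ) ∧
      (∀ σ : absoluteGaloisGroup ℚ, σ ∉ κ.layerSubgroup 1 → σ • θ = -θ) := by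
  obtain ⟨θ, hθ⟩ := IsCyclotomic.exists_sq_eq_two_layer_one hκ
  have hθ2 : (θ : AlgebraicClosure ℚ) ^ 2 = 2 := by
    have h := congrArg (fun x : κ.layer 1 ↦ (x : AlgebraicClosure ℚ)) hθ
    push_cast at h
    exact h
  refine ⟨θ, by rw [hθ2, map_ofNat], fun σ hσ ↦ smul_eq_of_mem_layerSubgroup_one θ.2 hσ,
    fun σ hσ ↦ smul_eq_neg_of_not_mem_layerSubgroup_one θ.2 hθ2 hσ⟩

/-! ## §2 The parity of the twist exponent -/

/-- **`σ ∈ κ⁻¹(2ℤ₂) ⟺ 2 ∣ twistExponent κ J σ`** for `J ≥ 1` (the exponent is `κ(σ) mod 2^J`, and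
`κ(σ) mod 2^J ≡ κ(σ) (mod 2)`). [cite: Washington1997, §13.1–§13.2] -/
theorem mem_layerSubgroup_one_iff_two_dvd_twistExponent (κ : ZpExtension ℚ 2) {J : ℕ} (hJ : 1 ≤ J)
    (σ : absoluteGaloisGroup ℚ) : σ ∈ κ.layerSubgroup 1 ↔ 2 ∣ κ.twistExponent J σ := by
  constructor
  · intro hσ
    have h := κ.prime_pow_dvd_twistExponent hJ hσ
    rwa [pow_one] at h
  · intro h2
    have hmod : κ.twistExponent J σ % 2 ^ 1 = κ.twistExponent 1 σ := κ.twistExponent_mod_pow J hJ σ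
    obtain ⟨c, hc⟩ := h2
    rw [pow_one, hc, Nat.mul_mod_right] at hmod
    -- `twistExponent 1 σ = 0` means `κ σ ∈ 2ℤ₂`
    have h0 : (PadicInt.toZModPow 1 (κ σ).toAdd).val = 0 := hmod.symm
    rw [ZMod.val_eq_zero] at h0
    have hker : (κ σ).toAdd ∈ RingHom.ker (PadicInt.toZModPow 1) := h0
    rw [PadicInt.ker_toZModPow, Ideal.mem_span_singleton] at hker
    rw [ZpExtension.mem_layerSubgroup]
    exact hker

/-- The sign `(−1)^{twistExponent κ J σ}` acting on an abelian group: the identity on `κ⁻¹(2ℤ₂)`, negation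
on the other coset (`J ≥ 1`). [cite: GreenbergLNM1716, §4 p. 105] -/
theorem neg_one_pow_twistExponent_smul (κ : ZpExtension ℚ 2) {J : ℕ} (hJ : 1 ≤ J)
    (σ : absoluteGaloisGroup ℚ) {M : Type*} [AddCommGroup M] (m : M) :
    ((-1 : ℤ) ^ κ.twistExponent J σ) • m = if σ ∈ κ.layerSubgroup 1 then m else -m := by
  by_cases hσ : σ ∈ κ.layerSubgroup 1
  · rw [if_pos hσ]
    obtain ⟨k, hk⟩ := (mem_layerSubgroup_one_iff_two_dvd_twistExponent κ hJ σ).mp hσ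
    rw [hk, pow_mul, neg_one_sq, one_pow, one_smul]
  · rw [if_neg hσ]
    have hodd : Odd (κ.twistExponent J σ) := by
      rcases Nat.even_or_odd (κ.twistExponent J σ) with he | ho
      · exact absurd ((mem_layerSubgroup_one_iff_two_dvd_twistExponent κ hJ σ).mpr
          (even_iff_two_dvd.mp he)) hσ
      · exact ho
    rw [hodd.neg_one_pow, neg_one_zsmul]

/-! ## §3 Transport of a local Kummer class into the twisted local Kummer condition (generic) -/

section Generic

variable {K : Type u} [Field K] [CharZero K] (W Y : WeierstrassCurve K) [Y.IsElliptic] (p : ℕ) [Fact p.Prime]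
  (κ : ZpExtension K p) (J : ℕ) (u : ℤ) (hu' : (p : ℤ) ∣ u - 1)
  (E : Type u) [Field E] [Algebra K E]

/-- **Transport of a local Kummer class.** Let `g : Y(K̄) ≃+ W(K̄)` and `g_E : Y(K̄_E) ≃+ W(K̄_E)` be additive
isomorphisms with `pointsMap_W ∘ g = g_E ∘ pointsMap_Y` and `g_E` equivariant for the local subgroup
`Gal(K̄_E/(K_∞)_w)`, and let `φ : Y[p^J] → E[p^J](χ_u)` be a `Γ_K`-intertwining map whose underlying map is `g`.
Then for `Q ∈ Y(K̄_E)` with `p^J Q ∈ Y(E)` and any subgroup `A ∋ p^k • g_E Q`, the image `H¹(φ|_E)(κ_E(Q))` of the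
local Kummer class of `Q` lies in `W.twistedTorsionLocalKummer p κ J u hu E A` — on `Gal(K̄_E/(K_∞)_w)` its cocycle is
`τ ↦ τ•g_E(Q) − g_E(Q)`. [cite: GreenbergLNM1716, §4 pp. 107, 124] [cite: SilvermanAEC2009, VIII.§2 and X.§4] -/
theorem map_localKummerClass_mem_twistedTorsionLocalKummer
    (g : Y.geomPoints ≃+ W.geomPoints) (gE : localPoints Y E ≃+ localPoints W E)
    (hsq : ∀ P : Y.geomPoints, pointsMap W E (g P) = gE (pointsMap Y E P))
    (hgE : ∀ τ : absoluteGaloisGroup E, τ ∈ localSubgroup κ.kerSubgroup E →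
      ∀ Q : localPoints Y E, gE (τ • Q) = τ • gE Q)
    (φ : (Y.torsionGaloisModule ((p ^ J : ℕ) : ℤ)).toContRepresentation →ⁱL
      (W.twistedTorsionGaloisModule p κ J u hu').toContRepresentation)
    (hφ : ∀ T : Y.geomTorsion ((p ^ J : ℕ) : ℤ),
      ((φ T : W.geomTorsion ((p ^ J : ℕ) : ℤ)) : W.geomPoints) = g (T : Y.geomPoints))
    (A : AddSubgroup (localPoints W E)) (Q : localPoints Y E)
    (hQ : (((p ^ J : ℕ) : ℤ)) • Q ∈ MulAction.fixedPoints (absoluteGaloisGroup E) (localPoints Y E))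
    (k : ℕ) (hA : p ^ k • gE Q ∈ A) :
    galoisCohomology.map (φ.restrictField E) 1
        (Y.localKummerClass ((p ^ J : ℕ) : ℤ)
          (by exact_mod_cast pow_ne_zero J (Fact.out : p.Prime).ne_zero) Q hQ) ∈
      W.twistedTorsionLocalKummer p κ J u hu' E A := by
  rw [WeierstrassCurve.localKummerClass, galoisCohomology.map_one_oneCocycleClass,
    WeierstrassCurve.mem_twistedTorsionLocalKummer_iff]
  refine ⟨_, gE Q, k, rfl, hA, fun τ ↦ ?_⟩
  rw [contOneCocycles.pullback_apply]
  change pointsMap W E ((φ.restrictField E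
      ((Y.localKummerCocycle ((p ^ J : ℕ) : ℤ) _ Q hQ).1 (τ : absoluteGaloisGroup E)) :
      W.geomTorsion ((p ^ J : ℕ) : ℤ)) : W.geomPoints) = _
  rw [ContIntertwiningMap.restrictField_apply, hφ, hsq, Y.pointsMap_localKummerCocycle_apply, map_sub,
    hgE τ τ.2]

/-- Hence **`H¹(φ|_E)` maps the local Kummer condition of `Y` into `W.twistedTorsionLocalKummer … E A`** as soon as
`A` contains a `p`-power multiple of `g_E(Q)` for every `Q` with `p^J Q ∈ Y(E)`.
[cite: GreenbergLNM1716, §4 p. 124] [cite: SilvermanAEC2009, X.§4] -/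
theorem map_kummerLocalConditionAt_le_twistedTorsionLocalKummer
    (g : Y.geomPoints ≃+ W.geomPoints) (gE : localPoints Y E ≃+ localPoints W E)
    (hsq : ∀ P : Y.geomPoints, pointsMap W E (g P) = gE (pointsMap Y E P))
    (hgE : ∀ τ : absoluteGaloisGroup E, τ ∈ localSubgroup κ.kerSubgroup E →
      ∀ Q : localPoints Y E, gE (τ • Q) = τ • gE Q)
    (φ : (Y.torsionGaloisModule ((p ^ J : ℕ) : ℤ)).toContRepresentation →ⁱL
      (W.twistedTorsionGaloisModule p κ J u hu').toContRepresentation)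
    (hφ : ∀ T : Y.geomTorsion ((p ^ J : ℕ) : ℤ),
      ((φ T : W.geomTorsion ((p ^ J : ℕ) : ℤ)) : W.geomPoints) = g (T : Y.geomPoints))
    (A : AddSubgroup (localPoints W E))
    (hA : ∀ Q : localPoints Y E,
      (((p ^ J : ℕ) : ℤ)) • Q ∈ MulAction.fixedPoints (absoluteGaloisGroup E) (localPoints Y E) →
        ∃ k : ℕ, p ^ k • gE Q ∈ A) :
    (Y.kummerLocalConditionAt ((p ^ J : ℕ) : ℤ) E).map (galoisCohomology.map (φ.restrictField E) 1) ≤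
      W.twistedTorsionLocalKummer p κ J u hu' E A := by
  have hn : (((p ^ J : ℕ) : ℤ)) ≠ 0 := by exact_mod_cast pow_ne_zero J (Fact.out : p.Prime).ne_zero
  rintro y ⟨c, hc, rfl⟩
  obtain ⟨Q, hQ, rfl⟩ :=
    (Y.mem_kummerLocalConditionAt_iff_exists_eq_localKummerClass ((p ^ J : ℕ) : ℤ) hn c).mp hc
  obtain ⟨k, hk⟩ := hA Q hQ
  exact map_localKummerClass_mem_twistedTorsionLocalKummer W Y p κ J u hu' E g gE hsq hgE φ hφ A Q hQ k hk

end Generic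

end Summit.BirchSwinnertonDyer.BirchSwinnertonDyer.Theorems.FlatBlindTwistSide

end
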